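import Summits.FinalStateConjecture.FinalStateConjecture.Theorems.WeakCosmicCensorshipMGHD.Negative.TruncatedMinkowski
import Literature.Geometry.Lorentzian.CauchyDevelopmentComap
import Literature.Geometry.Lorentzian.DataEmbeddingNormalSmooth
import Literature.Geometry.Lorentzian.CommonDevelopmentRigidity

/-!
# The lever `stub_scriTransfer` of line `scri-transfer-third-of-burial` is FALSE without each of
# its three bookkeeping clauses `IsCompact K`, `Kᶜ ⊆ range Φ`, and the far-completeness hypothesis
# — negative-side support for the crux `WeakCosmicCensorshipMGHD` (item `stmt-FinalStateConjecture-9952`)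

Companion of `ScriTransferNeedsOrientation.lean` (same seat). The registered lever (skeleton v2,
`Cruxes/WeakCosmicCensorshipMGHD/Lines/scri-transfer-third-of-burial.lean`, `stub_scriTransfer`)
concludes all-origin completeness of `𝓘⁺` of a Cauchy development `𝒟` of `D` from RELATIVE
far-origin completeness of a data embedding `𝒮` of a sub-datum `Φ^* D` embedded into `𝒟` over
`Φ`, granted a COMPACT `K ⊆ X` with `Kᶜ ⊆ range Φ`. Each of the three clauses is load-bearing:

* `scriTransferWithoutCompact_false` — delete `IsCompact K` (keep `Kᶜ ⊆ range Φ`): false;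
* `scriTransferWithoutCover_false` — delete `Kᶜ ⊆ range Φ` (keep `IsCompact K`): false;
* `scriTransferWithoutFar_false` — delete the relative far-completeness hypothesis: false.

One counter-model serves the first two: `𝒟 = truncated` (time-truncated Minkowski space
`{x⁰ < 1}`, incomplete `𝓘⁺`, landed `TruncatedMinkowski.lean`), `N` = the open unit ball of the
slice `ℝ³` with `Φ` = the inclusion (a smooth open embedding with identity differentials),
`𝒮 = truncated` RE-BASED along `Φ` (`DataEmbedding.comapAlong`: same spacetime, embedding `ι ∘ Φ`,
normal `ν ∘ Φ`), `χ = id`; the relative far-completeness hypothesis of `𝒮` then holds VACUOUSLY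
with the compact exempted set `K₁` = the closed unit ball (no origin of `N` lies outside it), and
`K = (range Φ)ᶜ` resp. `K = ∅` satisfies the surviving clause. For the third, `N = X`, `Φ = id`,
`𝒮 = 𝒟 = truncated`, `χ = id`, `K = ∅`.

Refuter seat `refuter-drefute-stmt-FinalStateConjecture-9952-g3-0` (drefute gen 3), 2026-08-16.
All results proved; `sorry`-free; axioms standard.

## References

* D. Christodoulou, CQG 16 (1999) A23, pp. A26–A27 (complete future null infinity, the role of
  the exempted compact set `B`).
* J. Sbierski, Ann. Henri Poincaré 17 (2016) 301–329, Def. 2.2 (developments of sub-data).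
-/

noncomputable section

open Bundle Set Function Filter TopologicalSpace Topology MeasureTheory
open scoped Manifold ContDiff Topology

set_option linter.dupNamespace false

namespace Summit.FinalStateConjecture.FinalStateConjecture.Theorems.WeakCosmicCensorshipMGHD.Negative

open Literature.Geometry.Lorentzian Literature.Geometry.Lorentzian.Minkowski

/-! ### The three mutated levers -/

/-- **`Sig.stub_scriTransfer` WITHOUT `IsCompact K`** (everything else verbatim skeleton v2). -/
def ScriTransferWithoutCompact : Prop :=
  ∀ (X : Type) [TopologicalSpace X] [ChartedSpace E3 X] [IsManifold (𝓡 3) ∞ X]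
    [T2Space X] [SecondCountableTopology X] [ConnectedSpace X]
    (D : InitialDataSet (𝓡 3) X) (𝒟 : CauchyDevelopment D)
    (N : Type) [TopologicalSpace N] [ChartedSpace E3 N] [IsManifold (𝓡 3) ∞ N] [ConnectedSpace N]
    (Φ : N → X) (hΦ : ContMDiff (𝓡 3) (𝓡 3) (∞ + 1) Φ)
    (hΦ' : ∀ u, Function.Injective (mfderiv (𝓡 3) (𝓡 3) Φ u)),
    Topology.IsOpenEmbedding Φ →
    ∀ (𝒮 : DataEmbedding (D.comap Φ hΦ hΦ')) (χ : 𝒮.carrier → 𝒟.carrier),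
      ContMDiff (𝓡 4) (𝓡 4) ∞ χ → Topology.IsOpenEmbedding χ →
      𝒮.metric.IsIsometricImmersion 𝒟.metric.toPseudoRiemannianMetric χ →
      𝒮.timeOrientation.PreservesTimeOrientation χ 𝒟.timeOrientation →
      χ ∘ 𝒮.embed = 𝒟.embed ∘ Φ →
      ∀ (K : Set X), Kᶜ ⊆ Set.range Φ →
      (∀ [𝒮.metric.HasLeviCivita],
        ∃ K₀ : Set X, IsCompact K₀ ∧ ∀ s : ℝ, 0 < s → ∃ K₁ : Set X, IsCompact K₁ ∧
          ∀ p : N, Φ p ∉ K₁ → ∀ (γ : ℝ → 𝒮.carrier) (dom : Set ℝ),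
            𝒮.metric.IsNormalisedNullRayFrom 𝒮.timeOrientation 𝒮.embed 𝒮.normal p γ dom →
            ¬ BddAbove dom ∨ ENNReal.ofReal s ≤ sojournTime γ dom
              (𝒮.metric.causalFuture 𝒮.timeOrientation (𝒮.embed '' (Φ ⁻¹' K₀)))) →
      _root_.Summit.FinalStateConjecture.HasCompleteNullInfinity 𝒟

/-- **`Sig.stub_scriTransfer` WITHOUT `Kᶜ ⊆ range Φ`** (everything else verbatim skeleton v2). -/
def ScriTransferWithoutCover : Prop :=
  ∀ (X : Type) [TopologicalSpace X] [ChartedSpace E3 X] [IsManifold (𝓡 3) ∞ X]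
    [T2Space X] [SecondCountableTopology X] [ConnectedSpace X]
    (D : InitialDataSet (𝓡 3) X) (𝒟 : CauchyDevelopment D)
    (N : Type) [TopologicalSpace N] [ChartedSpace E3 N] [IsManifold (𝓡 3) ∞ N] [ConnectedSpace N]
    (Φ : N → X) (hΦ : ContMDiff (𝓡 3) (𝓡 3) (∞ + 1) Φ)
    (hΦ' : ∀ u, Function.Injective (mfderiv (𝓡 3) (𝓡 3) Φ u)),
    Topology.IsOpenEmbedding Φ →
    ∀ (𝒮 : DataEmbedding (D.comap Φ hΦ hΦ')) (χ : 𝒮.carrier → 𝒟.carrier),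
      ContMDiff (𝓡 4) (𝓡 4) ∞ χ → Topology.IsOpenEmbedding χ →
      𝒮.metric.IsIsometricImmersion 𝒟.metric.toPseudoRiemannianMetric χ →
      𝒮.timeOrientation.PreservesTimeOrientation χ 𝒟.timeOrientation →
      χ ∘ 𝒮.embed = 𝒟.embed ∘ Φ →
      ∀ (K : Set X), IsCompact K →
      (∀ [𝒮.metric.HasLeviCivita],
        ∃ K₀ : Set X, IsCompact K₀ ∧ ∀ s : ℝ, 0 < s → ∃ K₁ : Set X, IsCompact K₁ ∧
          ∀ p : N, Φ p ∉ K₁ → ∀ (γ : ℝ → 𝒮.carrier) (dom : Set ℝ),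
            𝒮.metric.IsNormalisedNullRayFrom 𝒮.timeOrientation 𝒮.embed 𝒮.normal p γ dom →
            ¬ BddAbove dom ∨ ENNReal.ofReal s ≤ sojournTime γ dom
              (𝒮.metric.causalFuture 𝒮.timeOrientation (𝒮.embed '' (Φ ⁻¹' K₀)))) →
      _root_.Summit.FinalStateConjecture.HasCompleteNullInfinity 𝒟

/-- **`Sig.stub_scriTransfer` WITHOUT the relative far-completeness hypothesis** (everything else
verbatim skeleton v2). -/
def ScriTransferWithoutFar : Prop :=
  ∀ (X : Type) [TopologicalSpace X] [ChartedSpace E3 X] [IsManifold (𝓡 3) ∞ X]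
    [T2Space X] [SecondCountableTopology X] [ConnectedSpace X]
    (D : InitialDataSet (𝓡 3) X) (𝒟 : CauchyDevelopment D)
    (N : Type) [TopologicalSpace N] [ChartedSpace E3 N] [IsManifold (𝓡 3) ∞ N] [ConnectedSpace N]
    (Φ : N → X) (hΦ : ContMDiff (𝓡 3) (𝓡 3) (∞ + 1) Φ)
    (hΦ' : ∀ u, Function.Injective (mfderiv (𝓡 3) (𝓡 3) Φ u)),
    Topology.IsOpenEmbedding Φ →
    ∀ (𝒮 : DataEmbedding (D.comap Φ hΦ hΦ')) (χ : 𝒮.carrier → 𝒟.carrier),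
      ContMDiff (𝓡 4) (𝓡 4) ∞ χ → Topology.IsOpenEmbedding χ →
      𝒮.metric.IsIsometricImmersion 𝒟.metric.toPseudoRiemannianMetric χ →
      𝒮.timeOrientation.PreservesTimeOrientation χ 𝒟.timeOrientation →
      χ ∘ 𝒮.embed = 𝒟.embed ∘ Φ →
      ∀ (K : Set X), IsCompact K → Kᶜ ⊆ Set.range Φ →
      _root_.Summit.FinalStateConjecture.HasCompleteNullInfinity 𝒟

/-! ### The open unit ball of the slice as a sub-datum carrier -/

/-- The open unit ball of `ℝ³` as an open submanifold. -/
def ballOpens : Opens E3 := ⟨Metric.ball (0 : E3) 1, Metric.isOpen_ball⟩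

/-- Membership in the ball is `‖y‖ < 1`. -/
@[simp] theorem mem_ballOpens {y : E3} : y ∈ ballOpens ↔ ‖y‖ < 1 := by
  simp [ballOpens]

/-- The ball is connected (convex and nonempty). -/
theorem isConnected_ballOpens : IsConnected (ballOpens : Set E3) :=
  ((convex_ball (0 : E3) 1).isPathConnected ⟨0, by simp⟩).isConnected

/-- The ball is a connected space (as a sub-datum carrier it must be: `DataEmbedding` needs it). -/
instance connectedSpace_ballOpens : ConnectedSpace ballOpens :=
  isConnected_iff_connectedSpace.mp isConnected_ballOpens

/-- The inclusion of the ball into the slice `ℝ³ = ⊤`. -/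
def inclBall : ballOpens → slice := Opens.inclusion (le_top : ballOpens ≤ ⊤)

/-- The inclusion is `C^{∞+1}` (it is `C^n` for every `n`). -/
theorem contMDiff_inclBall : ContMDiff (𝓡 3) (𝓡 3) (∞ + 1) inclBall :=
  contMDiff_inclusion (le_top : ballOpens ≤ ⊤)

/-- The inclusion has injective (identity) differentials. -/
theorem injective_mfderiv_inclBall (u : ballOpens) :
    Function.Injective (mfderiv (𝓡 3) (𝓡 3) inclBall u) := by
  rw [inclBall, mfderiv_inclusion]
  exact fun _ _ h ↦ h

/-- The inclusion is an open embedding. -/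
theorem isOpenEmbedding_inclBall : Topology.IsOpenEmbedding inclBall :=
  Topology.IsOpenEmbedding.inclusion (show (ballOpens : Set E3) ⊆ ((⊤ : Opens E3) : Set E3) from
    fun _ _ ↦ trivial) (Metric.isOpen_ball.preimage continuous_subtype_val)

/-- The closed unit ball of the slice is compact. -/
theorem isCompact_closedUnitBall_slice :
    IsCompact ((Homeomorph.Set.univ E3) ⁻¹' Metric.closedBall (0 : E3) 1 : Set slice) :=
  (Homeomorph.Set.univ E3).isCompact_preimage.2 (isCompact_closedBall (0 : E3) 1)

/-- Every point of the ball lies in the closed unit ball of the slice. -/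
theorem inclBall_mem_closedUnitBall (p : ballOpens) :
    inclBall p ∈ ((Homeomorph.Set.univ E3) ⁻¹' Metric.closedBall (0 : E3) 1 : Set slice) := by
  have hp : ‖(p : E3)‖ < 1 := mem_ballOpens.1 p.2
  show ((p : E3)) ∈ Metric.closedBall (0 : E3) 1
  rw [mem_closedBall_zero_iff]
  exact hp.le

/-! ### The truncated development re-based over the ball -/

/-- **Time-truncated Minkowski space as a data embedding of the trivial datum restricted to the
unit ball**: the same spacetime `{x⁰ < 1}`, embedding `ι ∘ Φ`, normal `∂ₜ ∘ Φ`
(`DataEmbedding.comapAlong`; the displayed differentiability of the normal is the tree's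
`DataEmbedding.mdifferentiableAt_embed_normal`). -/
def truncatedBall : DataEmbedding (trivialData.comap inclBall contMDiff_inclBall injective_mfderiv_inclBall) :=
  truncated.toDataEmbedding.comapAlong inclBall contMDiff_inclBall injective_mfderiv_inclBall
    isOpenEmbedding_inclBall (fun u ↦ truncated.toDataEmbedding.mdifferentiableAt_embed_normal (inclBall u))

/-- The spacetime of the re-based truncated development is that of the truncated one (by `rfl`). -/
theorem truncatedBall_toSpacetime : truncatedBall.toSpacetime = truncated.toSpacetime := rfl

/-- The truncated development embeds into itself OVER the inclusion of the ball: the identity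
package of `EmbedsInto.refl`, with `χ ∘ (ι ∘ Φ) = ι ∘ Φ`. -/
theorem truncatedBall_embeds :
    ∃ χ : truncated.carrier → truncated.carrier,
      ContMDiff (𝓡 4) (𝓡 4) ∞ χ ∧ Topology.IsOpenEmbedding χ ∧
      truncated.metric.IsIsometricImmersion truncated.metric.toPseudoRiemannianMetric χ ∧
      truncated.timeOrientation.PreservesTimeOrientation χ truncated.timeOrientation ∧
      χ ∘ truncatedBall.embed = truncated.embed ∘ inclBall := by
  obtain ⟨χ, h1, h2, h3, h4, h5⟩ := CauchyDevelopment.EmbedsInto.refl truncated.toCauchyDevelopment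
  exact ⟨χ, h1, h2, h3, h4, funext fun u ↦ congrFun h5 (inclBall u)⟩

/-- **The relative far-completeness hypothesis of the lever holds VACUOUSLY for the re-based
truncated development**: exempt the compact closed unit ball `K₁`; no origin of the open ball lies
outside it. -/
theorem truncatedBall_relativelyFarComplete (K₀ : Set slice) (hK₀ : IsCompact K₀) :
    ∀ [truncatedBall.metric.HasLeviCivita],
      ∃ K₀' : Set slice, IsCompact K₀' ∧ ∀ s : ℝ, 0 < s → ∃ K₁ : Set slice, IsCompact K₁ ∧
        ∀ p : ballOpens, inclBall p ∉ K₁ → ∀ (γ : ℝ → truncatedBall.carrier) (dom : Set ℝ),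
          truncatedBall.metric.IsNormalisedNullRayFrom truncatedBall.timeOrientation truncatedBall.embed
              truncatedBall.normal p γ dom →
          ¬ BddAbove dom ∨ ENNReal.ofReal s ≤ sojournTime γ dom
            (truncatedBall.metric.causalFuture truncatedBall.timeOrientation
              (truncatedBall.embed '' (inclBall ⁻¹' K₀'))) := by
  intro _
  exact ⟨K₀, hK₀, fun s _ ↦ ⟨_, isCompact_closedUnitBall_slice,
    fun p hp ↦ absurd (inclBall_mem_closedUnitBall p) hp⟩⟩

/-! ### The three refutations -/

/-- **`IsCompact K` is load-bearing in `stub_scriTransfer`**: take `K = (range Φ)ᶜ` (closed, not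
compact), whose complement is `range Φ` tautologically, over the ball model; the vacuous relative
hypothesis and all embedding clauses hold, the conclusion `HasCompleteNullInfinity truncated` fails. -/
theorem scriTransferWithoutCompact_false : ¬ ScriTransferWithoutCompact := by
  intro hT
  obtain ⟨χ, h1, h2, h3, h4, h5⟩ := truncatedBall_embeds
  exact not_hasCompleteNullInfinity_truncated (hT slice trivialData truncated.toCauchyDevelopment
    ballOpens inclBall contMDiff_inclBall injective_mfderiv_inclBall isOpenEmbedding_inclBall
    truncatedBall χ h1 h2 h3 h4 h5 (Set.range inclBall)ᶜ (by rw [compl_compl])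
    (truncatedBall_relativelyFarComplete ∅ isCompact_empty))

/-- **`Kᶜ ⊆ range Φ` is load-bearing in `stub_scriTransfer`**: take `K = ∅` over the ball model. -/
theorem scriTransferWithoutCover_false : ¬ ScriTransferWithoutCover := by
  intro hT
  obtain ⟨χ, h1, h2, h3, h4, h5⟩ := truncatedBall_embeds
  exact not_hasCompleteNullInfinity_truncated (hT slice trivialData truncated.toCauchyDevelopment
    ballOpens inclBall contMDiff_inclBall injective_mfderiv_inclBall isOpenEmbedding_inclBall
    truncatedBall χ h1 h2 h3 h4 h5 ∅ isCompact_empty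
    (truncatedBall_relativelyFarComplete ∅ isCompact_empty))

/-- **The relative far-completeness hypothesis is load-bearing in `stub_scriTransfer`** (of course):
`N = X`, `Φ = id`, `𝒮 = 𝒟 = truncated`, `χ = id`, `K = ∅`. -/
theorem scriTransferWithoutFar_false : ¬ ScriTransferWithoutFar := by
  intro hT
  have hΦ : ContMDiff (𝓡 3) (𝓡 3) (∞ + 1) (id : slice → slice) := contMDiff_id
  have hΦ' : ∀ u, Function.Injective (mfderiv (𝓡 3) (𝓡 3) (id : slice → slice) u) := fun u ↦ by
    rw [mfderiv_id]
    exact fun _ _ h ↦ h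
  have key : ∀ {D' : InitialDataSet (𝓡 3) slice} (_ : D' = trivialData.comap id hΦ hΦ')
      (𝒮 : DataEmbedding D') (χ : 𝒮.carrier → truncated.carrier),
      ContMDiff (𝓡 4) (𝓡 4) ∞ χ → Topology.IsOpenEmbedding χ →
      𝒮.metric.IsIsometricImmersion truncated.metric.toPseudoRiemannianMetric χ →
      𝒮.timeOrientation.PreservesTimeOrientation χ truncated.timeOrientation →
      χ ∘ 𝒮.embed = truncated.embed →
      _root_.Summit.FinalStateConjecture.HasCompleteNullInfinity truncated.toCauchyDevelopment := by
    intro D' hD' 𝒮 χ h1 h2 h3 h4 h5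
    subst hD'
    exact hT slice trivialData truncated.toCauchyDevelopment slice id hΦ hΦ' IsOpenEmbedding.id 𝒮 χ
      h1 h2 h3 h4 h5 ∅ isCompact_empty (by simp)
  obtain ⟨χ, h1, h2, h3, h4, h5⟩ := CauchyDevelopment.EmbedsInto.refl truncated.toCauchyDevelopment
  exact not_hasCompleteNullInfinity_truncated
    (key (InitialDataSet.comap_eq_self_of_eq_id trivialData hΦ hΦ' rfl).symm
      truncated.toDataEmbedding χ h1 h2 h3 h4 h5)

end Summit.FinalStateConjecture.FinalStateConjecture.Theorems.WeakCosmicCensorshipMGHD.Negative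

end
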